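import Summits.AtomisticToContinuum.BoseEinsteinCondensation.Theorems.BECProbeMassFlowRecoilTransferDetour

/-!
# Crux `RecoilTransfer` (stmt-AtomisticToContinuum-12311) — strategist r1: typed census companion

Companion to `Cruxes/RecoilTransfer/STRATEGY-CENSUS.md` §r1.  Sorry-free.  It records the one
new *checked* fact the second strategist pass adds to the summit-strength dossier of the crux:

* `WeakStaticFloor` — "no COMPLETE static orthogonality catastrophe": for every repulsive
  finite-range `v` SOME fixed fraction `c₀ > 0` of zero-cloud-momentum weight survives on
  near-minimisers of the pinned-scatterer problem, eventually in `N` at low density.  This is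
  strictly weaker in shape than the sibling crux `CloudMomentumAtom` (which asks `1 - ε` for every
  `ε`): `weakStaticFloor_of_cloudMomentumAtom`.
* `periodicBEC_of_recoilTransfer_of_weakStaticFloor` — `RecoilTransfer` together with ANY positive
  static floor already yields the periodic-BEC body (the hypothesis of `BoundaryTransferWeak`) for
  every `v`, with condensate fraction `c₀ / 2`; hence
  `boseEinsteinCondensation_of_recoilTransfer_of_weakStaticFloor :
     RecoilTransfer → WeakStaticFloor → BoundaryTransferWeak → BoseEinsteinCondensation`.

Reading for the tribunal (T1, "print placing C ≥ S"): a proof of `RecoilTransfer` at any single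
`ε < c₀` is a proof of thermodynamic-limit Bose–Einstein condensation of the periodic dilute gas at
fraction `≥ c₀ - ε`, *unless* the static cloud of the same gas suffers an orthogonality catastrophe
complete to within `ε` — the branch every physical source excludes in `d = 3`
([GuentherEtAl2021, eq. (14)]: deficit `≈ 0.886 (b/a)² √(ρa³) → 0`; Sun–Rambow–Si,
cond-mat/0404590: no bosonic OC in a 3-D condensate).  So the crux carries the conjunct not only
"modulo `CloudMomentumAtom`" (c4, `recoilTransfer_iff_completeCondensation_of_cloudMomentumAtom`)
but modulo the far weaker `WeakStaticFloor`.

References: [LSSY2005, Ch. 5, App. A], [GuentherEtAl2021], [Fournais2020] (route sources; no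
mathematical content of theirs is used — the proofs below are logic plus `Filter`/`ENNReal`
bookkeeping, the same glue as `becProbeMassFlow_staticFloorCondenses_proof`).
-/

namespace Summit.AtomisticToContinuum.BoseEinsteinCondensation.Cruxes.RecoilTransfer.StrategyCensusR1

open Filter
open Literature.MathematicalPhysics.QuantumManyBody.BoseGas
open Summit.AtomisticToContinuum.BoseEinsteinCondensation.Theses.BECProbeMassFlow

/-- The periodic-BEC body for one potential `v`: syntactically the hypothesis of
`BoundaryTransferWeak v hv` (the stmt-0826 shape). [folklore] -/
def PeriodicBECBody (v : ℝ → ENNReal) : Prop :=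
  ∃ ρ₀ : ℝ, 0 < ρ₀ ∧ ∀ ρ : ℝ, 0 < ρ → ρ < ρ₀ → ∃ c : ℝ, 0 < c ∧ ∀ᶠ N : ℕ in Filter.atTop,
    ∃ δ : ENNReal, 0 < δ ∧ ∀ Ψ : PeriodicTrialState N (sideLength ρ N),
      periodicEnergy v Ψ ≤ periodicGroundStateEnergy v N (sideLength ρ N) + δ →
        ENNReal.ofReal (c * N) ≤ condensateOccupation N (sideLength ρ N) Ψ.ψ

/-- A static floor AT LEVEL `c₀` for `v`: eventually in `N` at low density, some slack `δ > 0` makes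
every `δ`-near-minimiser `Φ` of the pinned-scatterer problem (`N` bosons, torus of side
`sideLength ρ (N+1)`) satisfy `ofReal (c₀ · L⁶) ≤ ∫⁻ ‖∫ Φ.ψ(X + t)dt‖²` (i.e. `w₀(Φ) ≥ c₀`).
`CloudMomentumAtom`'s body is `∀ ε > 0, StaticFloorAt v (1 - ε)`. [folklore] -/
def StaticFloorAt (v : ℝ → ENNReal) (c₀ : ℝ) : Prop :=
  ∃ ρ₀ : ℝ, 0 < ρ₀ ∧ ∀ ρ : ℝ, 0 < ρ → ρ < ρ₀ → ∀ᶠ N : ℕ in Filter.atTop,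
    ∃ δ : ENNReal, 0 < δ ∧ ∀ Φ : PeriodicTrialState N (sideLength ρ (N + 1)),
      impurityPeriodicEnergy v 0 Φ ≤ impurityPeriodicGroundStateEnergy v N (sideLength ρ (N + 1)) 0 + δ →
        ENNReal.ofReal (c₀ * sideLength ρ (N + 1) ^ 6) ≤
          ∫⁻ X in cellN N (sideLength ρ (N + 1)),
            (‖∫ t in cell (sideLength ρ (N + 1)), Φ.ψ (X + fun _ => t)‖₊ : ENNReal) ^ 2

/-- **No complete static orthogonality catastrophe**: every repulsive finite-range `v` admits SOME
positive static floor `c₀ > 0` (fixed, not asymptotically full). [folklore] -/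
def WeakStaticFloor : Prop :=
  ∀ v : ℝ → ENNReal, IsRepulsiveFiniteRange v → ∃ c₀ : ℝ, 0 < c₀ ∧ StaticFloorAt v c₀

/-- The sibling crux gives a floor at every level `< 1`; in particular `WeakStaticFloor` (take
`ε = 1/2`, `c₀ = 1/2`).  So `WeakStaticFloor` is weaker in shape than `CloudMomentumAtom`.
[folklore] -/
theorem weakStaticFloor_of_cloudMomentumAtom (h1 : CloudMomentumAtom) : WeakStaticFloor := by
  intro v hv
  refine ⟨1 - 1 / 2, by norm_num, ?_⟩
  exact h1 v hv (1 / 2) (by norm_num)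

/-- **Core glue.**  For one potential `v`: a static floor at level `c₀ > 0` and the `RecoilTransfer`
body for `v` give the periodic-BEC body for `v` with fraction `c₀ / 2`.
Proof: `ε := c₀ / 2` in the recoil body, `ρ₀ := min`, intersect the eventual sets, feed the floor's
`δ` as `δ₁` with constant `c := c₀`, obtain `δ₂` and `ofReal ((c₀ - c₀/2) · ↑(N+1)) ≤ n₀`, and shift
`N ↦ N + 1` inside `∀ᶠ` (`Filter.map_add_atTop_eq_nat 1`). [folklore] -/
theorem periodicBECBody_of_floorAt_of_recoilBody (v : ℝ → ENNReal) (c₀ : ℝ) (hc₀ : 0 < c₀)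
    (hF : StaticFloorAt v c₀)
    (hR : ∀ ε : ℝ, 0 < ε → ∃ ρ₀ : ℝ, 0 < ρ₀ ∧ ∀ ρ : ℝ, 0 < ρ → ρ < ρ₀ → ∀ᶠ N : ℕ in Filter.atTop,
      ∀ c : ℝ, ∀ δ₁ : ENNReal, 0 < δ₁ →
        (∀ Φ : PeriodicTrialState N (sideLength ρ (N + 1)),
          impurityPeriodicEnergy v 0 Φ ≤ impurityPeriodicGroundStateEnergy v N (sideLength ρ (N + 1)) 0 + δ₁ →
            ENNReal.ofReal (c * sideLength ρ (N + 1) ^ 6) ≤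
              ∫⁻ X in cellN N (sideLength ρ (N + 1)),
                (‖∫ t in cell (sideLength ρ (N + 1)), Φ.ψ (X + fun _ => t)‖₊ : ENNReal) ^ 2) →
        ∃ δ₂ : ENNReal, 0 < δ₂ ∧ ∀ Ω : PeriodicTrialState (N + 1) (sideLength ρ (N + 1)),
          periodicEnergy v Ω ≤ periodicGroundStateEnergy v (N + 1) (sideLength ρ (N + 1)) + δ₂ →
            ENNReal.ofReal ((c - ε) * ((N + 1 : ℕ) : ℝ)) ≤
              condensateOccupation (N + 1) (sideLength ρ (N + 1)) Ω.ψ) :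
    PeriodicBECBody v := by
  obtain ⟨ρ₁, hρ₁, H1⟩ := hF
  obtain ⟨ρ₂, hρ₂, H2⟩ := hR (c₀ / 2) (by positivity)
  refine ⟨min ρ₁ ρ₂, lt_min hρ₁ hρ₂, fun ρ hρ hρlt => ⟨c₀ / 2, by positivity, ?_⟩⟩
  have E1 := H1 ρ hρ (lt_of_lt_of_le hρlt (min_le_left _ _))
  have E2 := H2 ρ hρ (lt_of_lt_of_le hρlt (min_le_right _ _))
  rw [← Filter.map_add_atTop_eq_nat 1, Filter.eventually_map]
  filter_upwards [E1, E2] with N hN1 hN2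
  obtain ⟨δ₁, hδ₁, hfloor⟩ := hN1
  obtain ⟨δ₂, hδ₂, hocc⟩ := hN2 c₀ δ₁ hδ₁ hfloor
  refine ⟨δ₂, hδ₂, fun Ω hΩ => ?_⟩
  have h := hocc Ω hΩ
  have h12 : (c₀ - c₀ / 2) = c₀ / 2 := by ring
  rw [h12] at h
  exact h

/-- **`RecoilTransfer` + any positive static floor ⇒ periodic BEC for every `v`.** [folklore] -/
theorem periodicBEC_of_recoilTransfer_of_weakStaticFloor (h2 : RecoilTransfer)
    (hW : WeakStaticFloor) :
    ∀ v : ℝ → ENNReal, IsRepulsiveFiniteRange v → PeriodicBECBody v := by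
  intro v hv
  obtain ⟨c₀, hc₀, hF⟩ := hW v hv
  exact periodicBECBody_of_floorAt_of_recoilBody v c₀ hc₀ hF (h2 v hv)

/-- **The conjunct from `RecoilTransfer`, the weak floor and the boundary transfer** — the route's
`closes` with `CloudMomentumAtom` replaced by the weaker `WeakStaticFloor` (and the proved glue
`StaticFloorCondenses` inlined).  This is the Lean shadow of the summit-strength reading of the
crux recorded in `STRATEGY-CENSUS.md` §r1. [folklore] -/
theorem boseEinsteinCondensation_of_recoilTransfer_of_weakStaticFloor (h2 : RecoilTransfer)
    (hW : WeakStaticFloor) (h4 : BoundaryTransferWeak) : _root_.BoseEinsteinCondensation :=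
  fun v hv => h4 v hv (periodicBEC_of_recoilTransfer_of_weakStaticFloor h2 hW v hv)

/-- Sanity link with the route as filed: the route's own chain is the special case
`WeakStaticFloor := weakStaticFloor_of_cloudMomentumAtom h1`. [folklore] -/
theorem closes_via_weakFloor (h1 : CloudMomentumAtom) (h2 : RecoilTransfer)
    (h4 : BoundaryTransferWeak) : _root_.BoseEinsteinCondensation :=
  boseEinsteinCondensation_of_recoilTransfer_of_weakStaticFloor h2
    (weakStaticFloor_of_cloudMomentumAtom h1) h4

end Summit.AtomisticToContinuum.BoseEinsteinCondensation.Cruxes.RecoilTransfer.StrategyCensusR1
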